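import Literature.Computability.QuantumComplexity.BlockSensitivityQuantumBound
import HarnessLib

/-!
# Sensitive bits lower-bound quantum queries: `√s_x(f) ≤ 4·Q₂(f)`; `bs(AND_N) = bs(OR_N) = N`, `Q₂(AND_N) ≥ √N/4`

Beals–Buhrman–Cleve–Mosca–de Wolf, *Quantum lower bounds by polynomials*, J. ACM 48 (2001)
778–797 (arXiv:quant-ph/9802049, held TeX `paper:arxiv-quant-ph_9802049`):

* §1.2 (chunk 4 of the held source): "For OR, AND, PARITY, MAJORITY, we obtain the bounds in the
  table below (all given numbers are both necessary and sufficient)" — bounded-error row: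
  `Q₂(OR_N), Q₂(AND_N) ∈ Θ(√N)`; "the `Θ(√N)`-bounds for OR and AND in the bounded-error setting
  … appear in [Grover; Bennett–Bernstein–Brassard–Vazirani; Boyer–Brassard–Høyer–Tapp; Zalka]".
* §6 (chunk 12): "Since `bs(OR) = N`, Theorem 4.13 gives us a lower bound of `¼√N` on computing
  the OR with bounded error probability"; chunk 13: "AND, like OR, requires …" (the AND bounds are
  obtained from the OR bounds by the symmetry `x ↦ ¬x`).

The tree already PROVES Theorem 4.13, `bs(f) ≤ 16·Q₂(f)²`
(`blockSensitivity_le_sixteen_mul_sq`, `BlockSensitivityQuantumBound.lean`) and the OR corollary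
`√N ≤ 4·Q₂(OR_N)` (`sqrt_le_four_mul_quantumQueryComplexity_orFn`, `GroverSearchLowerBound.lean`,
by a direct symmetrization). This file adds the form in which instance-level consumers use
Theorem 4.13 — WITHOUT computing `bs(f)` exactly:

* `card_le_blockSensitivity_of_singletons` — if at some input `x` each single bit `i ∈ S` is
  sensitive (`f(x^{{i}}) ≠ f(x)`), then `#S ≤ bs(f)` (the singletons `{i}`, `i ∈ S`, are a family
  of pairwise disjoint sensitive blocks in the sense of Def. 4.11; i.e. `s_x(f) ≤ bs_x(f) ≤ bs(f)`,
  Buhrman–de Wolf 2002 §3);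
* `sqrt_card_le_four_mul_quantumQueryComplexity_of_singletons` — hence `√#S ≤ 4·Q₂(f)`;
* `andFn`, `blockSensitivity_andFn : bs(AND_N) = N`, `blockSensitivity_orFn : bs(OR_N) = N`
  (§6, "`bs(OR) = N`"), and `sqrt_le_four_mul_quantumQueryComplexity_andFn : √N ≤ 4·Q₂(AND_N)`
  (Table 1, bounded-error AND), valid for every `N` (both sides vanish at `N = 0`).

Consumer (cell pub-qadeq, register row A-168 / OPEN-56): deciding whether an `n`-vertex graph is
complete from adjacency queries is the AND of the `n(n-1)/2` edge bits, so every bounded-error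
quantum query algorithm needs at least `√(n(n-1)/2)/4` queries — apply
`sqrt_card_le_four_mul_quantumQueryComplexity_of_singletons` at the complete graph with `S` = all
edges (the Summits-side corollary lives under `Summits/QuantumAdvantage/Dequantization/`).

No named facts; everything is proved from the tree's Theorem 4.13.

## References
* R. Beals, H. Buhrman, R. Cleve, M. Mosca, R. de Wolf, *Quantum lower bounds by polynomials*,
  J. ACM 48 (2001) 778–797, §1.2 Table 1, Def. 4.11, Thm. 4.13, §6 [BealsEtAl2001].
* H. Buhrman, R. de Wolf, *Complexity measures and decision tree complexity: a survey*,
  Theoret. Comput. Sci. 288 (2002) 21–43, §3 (sensitivity `s(f) ≤ bs(f)`) [Wolf2002].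
-/

namespace Literature.Computability.QuantumComplexity

open Finset Literature.Computability.Cryptography Literature.Computability.Complexity

variable {N : ℕ}

/-! ### Singleton sensitive blocks -/

/-- If every bit `i ∈ S` is individually sensitive for `f` at `x` (`f(x^{{i}}) ≠ f(x)`), the
singletons `{i}`, `i ∈ S`, form a family of pairwise disjoint sensitive blocks, so `#S ≤ bs_x(f)`
(sensitivity at `x` is at most block sensitivity at `x`). [cite: BealsEtAl2001, Def 4.11]
[cite: Wolf2002, §3] -/
theorem card_le_blockSensitivityAt_of_singletons (f : (Fin N → Bool) → Bool) (x : Fin N → Bool)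
    (S : Finset (Fin N)) (h : ∀ i ∈ S, f (flipBlock x {i}) ≠ f x) :
    S.card ≤ blockSensitivityAt f x := by
  classical
  have hinj : Set.InjOn (fun i : Fin N => ({i} : Finset (Fin N))) S :=
    fun i _ j _ hij => Finset.singleton_injective hij
  have hfam : IsSensitiveFamily f x (S.image fun i => ({i} : Finset (Fin N))) := by
    refine ⟨?_, ?_⟩
    · intro B hB
      obtain ⟨i, hi, rfl⟩ := Finset.mem_image.1 hB
      exact h i hi
    · intro A hA B hB hAB
      obtain ⟨i, hi, rfl⟩ := Finset.mem_image.1 (Finset.mem_coe.1 hA)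
      obtain ⟨j, hj, rfl⟩ := Finset.mem_image.1 (Finset.mem_coe.1 hB)
      have hij : i ≠ j := fun hij => hAB (by rw [hij])
      simpa [Function.onFun] using hij
  calc S.card = (S.image fun i => ({i} : Finset (Fin N))).card :=
        (Finset.card_image_of_injOn hinj).symm
    _ ≤ blockSensitivityAt f x := hfam.card_le

/-- `#S ≤ bs(f)` whenever every bit of `S` is individually sensitive for `f` at some input `x`.
[cite: BealsEtAl2001, Def 4.11] [cite: Wolf2002, §3] -/
theorem card_le_blockSensitivity_of_singletons (f : (Fin N → Bool) → Bool) (x : Fin N → Bool)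
    (S : Finset (Fin N)) (h : ∀ i ∈ S, f (flipBlock x {i}) ≠ f x) :
    S.card ≤ blockSensitivity f :=
  (card_le_blockSensitivityAt_of_singletons f x S h).trans (blockSensitivityAt_le f x)

/-- **Sensitive bits lower-bound bounded-error quantum queries**: if every bit of `S` is
individually sensitive for `f` at some input `x`, then `√#S ≤ 4·Q₂(f)` (Thm. 4.13,
`bs(f) ≤ 16 Q₂(f)²`, with `#S ≤ bs(f)`). [cite: BealsEtAl2001, Thm 4.13] -/
theorem sqrt_card_le_four_mul_quantumQueryComplexity_of_singletons (f : (Fin N → Bool) → Bool)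
    (x : Fin N → Bool) (S : Finset (Fin N)) (h : ∀ i ∈ S, f (flipBlock x {i}) ≠ f x) :
    Real.sqrt (S.card : ℝ) ≤ 4 * (quantumQueryComplexity (1 / 3) f : ℝ) := by
  have hS : (S.card : ℝ) ≤ (blockSensitivity f : ℝ) := by
    exact_mod_cast card_le_blockSensitivity_of_singletons f x S h
  have hbs := blockSensitivity_le_sixteen_mul_sq_real f
  have hQ : (0 : ℝ) ≤ (quantumQueryComplexity (1 / 3) f : ℝ) := Nat.cast_nonneg _
  calc Real.sqrt (S.card : ℝ)
      ≤ Real.sqrt ((4 * (quantumQueryComplexity (1 / 3) f : ℝ)) ^ 2) :=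
        Real.sqrt_le_sqrt (by nlinarith)
    _ = 4 * (quantumQueryComplexity (1 / 3) f : ℝ) := Real.sqrt_sq (by positivity)

/-! ### `AND_N` and `OR_N` -/

/-- The `N`-bit AND function, `AND(x) = true ↔ ∀ i, xᵢ = true`. [cite: BealsEtAl2001, §1.2]
[cite: Wolf2002, §3] -/
def andFn (N : ℕ) (x : Fin N → Bool) : Bool :=
  decide (∀ i, x i = true)

/-- `andFn N x = true` iff every bit of `x` is set. [cite: Wolf2002, §3] -/
@[simp]
theorem andFn_eq_true_iff (x : Fin N → Bool) : andFn N x = true ↔ ∀ i, x i = true := by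
  simp [andFn]

/-- At the all-ones input every single bit is sensitive for `AND_N`. [cite: BealsEtAl2001, §6] -/
theorem andFn_flipBlock_singleton_allOnes (i : Fin N) :
    andFn N (flipBlock (fun _ => true) {i}) ≠ andFn N (fun _ => true) := by
  have h1 : andFn N (fun _ => true) = true := by simp
  have h2 : andFn N (flipBlock (fun _ => true) {i}) = false := by
    rw [Bool.eq_false_iff, Ne, andFn_eq_true_iff, not_forall]
    exact ⟨i, by simp⟩
  rw [h1, h2]; decide

/-- At the all-zeros input every single bit is sensitive for `OR_N`. [cite: BealsEtAl2001, §6] -/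
theorem orFn_flipBlock_singleton_allZeros (i : Fin N) :
    orFn N (flipBlock (fun _ => false) {i}) ≠ orFn N (fun _ => false) := by
  have h1 : orFn N (fun _ => false) = false := by
    rw [Bool.eq_false_iff, Ne, orFn_eq_true_iff]; simp
  have h2 : orFn N (flipBlock (fun _ => false) {i}) = true := by
    rw [orFn_eq_true_iff]
    exact ⟨i, by simp⟩
  rw [h1, h2]; decide

/-- **`bs(AND_N) = N`.** [cite: BealsEtAl2001, §6] -/
theorem blockSensitivity_andFn (N : ℕ) : blockSensitivity (andFn N) = N := by
  refine le_antisymm (blockSensitivity_le _) ?_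
  simpa using card_le_blockSensitivity_of_singletons (andFn N) (fun _ => true) Finset.univ
    (fun i _ => andFn_flipBlock_singleton_allOnes i)

/-- **`bs(OR_N) = N`** ("Since `bs(OR) = N`, Theorem 4.13 gives us a lower bound of `¼√N`").
[cite: BealsEtAl2001, §6] -/
theorem blockSensitivity_orFn (N : ℕ) : blockSensitivity (orFn N) = N := by
  refine le_antisymm (blockSensitivity_le _) ?_
  simpa using card_le_blockSensitivity_of_singletons (orFn N) (fun _ => false) Finset.univ
    (fun i _ => orFn_flipBlock_singleton_allZeros i)

/-- **`Q₂(AND_N) ≥ √N/4`** (Table 1, bounded-error AND: `Θ(√N)`; the lower half via Thm. 4.13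
and `bs(AND_N) = N`), for every `N`. [cite: BealsEtAl2001, §1.2 Table 1, Thm 4.13, §6] -/
theorem sqrt_le_four_mul_quantumQueryComplexity_andFn (N : ℕ) :
    Real.sqrt N ≤ 4 * (quantumQueryComplexity (1 / 3) (andFn N) : ℝ) := by
  simpa using sqrt_card_le_four_mul_quantumQueryComplexity_of_singletons (andFn N)
    (fun _ => true) Finset.univ (fun i _ => andFn_flipBlock_singleton_allOnes i)

end Literature.Computability.QuantumComplexity
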